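import Mathlib
import Summits.MatrixMultiplication.MatrixMultiplication.Theorems.GradedDesignFamily.Negative.CuspFormWallSharp
import Summits.MatrixMultiplication.MatrixMultiplication.Theorems.GradedDesignFamily.Negative.SubfieldCellUniformWall
import Summits.MatrixMultiplication.MatrixMultiplication.Theorems.GradedDesignFamily.Negative.SubfieldCellLineReps

/-!
# The SHARP counting wall `(|K| + 1)(|k| − 1)` of the quadratic-extension cell, for EVERY
# finite field and the algebraic embedding
# (crux `LevelGradedCohnUmans.GradedDesignFamily`, stmt-MatrixMultiplication-7610; negative side,
# line `quadratic-extension-level-one-cell`, stub S3 `stub_subfieldCell`)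

HONEST FRAMING.  This DECIDES nothing about the summit and nothing about the asymptotic stub S3;
it is a THEOREM about the finite cells of S3, uniform in the field: a VERDICT / CERTIFICATE for the
cell census (SUBFIELD.md §0, §19.5 conjecture `C(q) ≤ (q² + 1)(q − 1)`), not summit progress.

`subfieldCell_wall_sharp_uniform`: for every finite field `k`, every field `K` that is a
`k`-algebra with `|K| = |k|²`, the standard embedding `φ = mapGL K : SL₂(k) →* GL₂(K)` and all
non-empty `Y, Z ⊆ GL₂(K)` separated from `φ(SL₂ k)` exactly as in S3:
`|Y| + |Z| ≤ (|K| + 1)(|k| − 1)`.  At `|k| = 2, 3, 4, 5` this is `5, 20, 51, 104` — the census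
maxima, previously certified field by field (`q ≤ 5`) and conjectured for all `q` (SUBFIELD §19.5);
now a theorem for all `q` (for the algebraic embeddings; at `q = 3, 4, 5` the landed embedding
classifications transport it to every injective `φ`).

Proof = `cuspFormWall_sharp` with
* the elliptic extended trace form `e = extTraceForm (ellTau s₀)` of `SubfieldCellUniformWall`
  (cuspidal, `Σ e = 0`), and
* the STEINBERG KERNEL VECTOR: the constant family `κ_ℓ = 1_{Kˣ·w₀}` (indicator of the punctured
  line through `w₀ = (1, θ)`, `θ ∈ K ∖ k`; `exists_not_mem_range_algebraMap`).
  - `hκ0` (`lineRep_count`): for every `A ∈ GL₂(K)` exactly ONE line representative `ℓ ∈ LR`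
    has `A ℓ ∈ Kˣ·w₀` (`LR` is an exact system of representatives of the lines — companion file
    `SubfieldCellLineReps`), so `Σ_ℓ Σ_t e(t) κ(φ(t) g ℓ) = Σ_t e(t) = 0`;
  - `hκ1` (`stab_sum_ne_zero`): `Σ_t e(t) κ(φ(t) w₀) = Σ_{t ∈ S} e(t)` over the stabiliser `S` of
    the punctured line; `±1 ∈ S` contribute `−2|k|` through the `δ_{±1}` part, and the trace part
    contributes at most `#{t ∈ S : tr t = 2} + #{t ∈ S : tr t = −2} ≤ 1 + 1`, because `t ∈ S` with
    `φ(t) w₀ = c·w₀` forces `c² − tr(t) c + 1 = 0` (`stab_charpoly`), so `tr t = ±2` gives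
    `c = ±1`, `φ(t ∓ 1) w₀ = 0`, and a `k`-matrix killing `(1, θ)` with `θ ∉ k` is zero
    (`mapMatrix_mulVec_eq_zero`): `t = ±1` (`stab_trace_two`, `stab_trace_neg_two`).  Hence
    `Σ_{t ∈ S} e(t) ≤ 2 − 2|k| < 0`.

Sorry-free; axioms `propext`, `Classical.choice`, `Quot.sound`.
-/

set_option linter.dupNamespace false

open scoped BigOperators
open Matrix

namespace Summit.MatrixMultiplication.MatrixMultiplication.Theorems.GradedDesignFamily.Negative


section Stabiliser

variable {k K : Type} [Field k] [Fintype k] [DecidableEq k] [Field K] [Fintype K] [DecidableEq K]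
  [Algebra k K]

omit [Fintype k] [DecidableEq k] [Fintype K] [DecidableEq K] in
/-- The matrix of `mapGL K t` is `t` mapped entrywise by `algebraMap k K`. -/
theorem mapGL_coe (t : Matrix.SpecialLinearGroup (Fin 2) k) :
    ((Matrix.SpecialLinearGroup.mapGL K t : Matrix.GeneralLinearGroup (Fin 2) K) :
      Matrix (Fin 2) (Fin 2) K) = (t : Matrix (Fin 2) (Fin 2) k).map (algebraMap k K) := rfl

omit [DecidableEq k] [DecidableEq K] in
/-- A quadratic extension has an element outside the ground field. [folklore] -/
theorem exists_not_mem_range_algebraMap (hK : Fintype.card K = Fintype.card k ^ 2) :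
    ∃ θ : K, θ ∉ Set.range (algebraMap k K) := by
  by_contra! h
  have hsurj : Function.Surjective (algebraMap k K) := fun θ => h θ
  have hle := Fintype.card_le_of_surjective _ hsurj
  have h1 : 1 < Fintype.card k := Fintype.one_lt_card
  have h2 : Fintype.card k < Fintype.card k ^ 2 := by nlinarith
  omega

omit [Fintype k] [DecidableEq k] [Fintype K] [DecidableEq K] in
/-- A `k`-matrix killing `(1, θ)` with `θ ∉ k` is zero. [folklore] -/
theorem mapMatrix_mulVec_eq_zero {θ : K} (hθ : θ ∉ Set.range (algebraMap k K))
    (N : Matrix (Fin 2) (Fin 2) k) (h : (N.map (algebraMap k K)) *ᵥ ![1, θ] = 0) : N = 0 := by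
  ext i j
  have hi := congrFun h i
  simp only [Matrix.mulVec, dotProduct, Fin.sum_univ_two, Matrix.map_apply, Matrix.cons_val_zero,
    Matrix.cons_val_one, mul_one, Pi.zero_apply] at hi
  -- hi : ι (N i 0) + ι (N i 1) * θ = 0
  have hN1 : N i 1 = 0 := by
    by_contra hne
    have hι : algebraMap k K (N i 1) ≠ 0 := (map_ne_zero_iff _ (algebraMap k K).injective).2 hne
    apply hθ
    refine ⟨-(N i 0) / N i 1, ?_⟩
    rw [map_div₀, map_neg, div_eq_iff hι]
    linear_combination -hi
  have hN0 : N i 0 = 0 := by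
    rw [hN1, map_zero, zero_mul, add_zero, map_eq_zero_iff _ (algebraMap k K).injective] at hi
    exact hi
  fin_cases j
  · exact hN0
  · exact hN1

omit [Fintype k] [DecidableEq k] [Fintype K] [DecidableEq K] in
/-- If `φ(t)` (`φ = mapGL K`) maps `w₀ = (1, θ)` to `c·w₀`, then `c² − tr(t)·c + 1 = 0`.
[folklore] -/
theorem stab_charpoly (θ : K) (t : Matrix.SpecialLinearGroup (Fin 2) k) (c : K)
    (hc : ((Matrix.SpecialLinearGroup.mapGL K t : Matrix.GeneralLinearGroup (Fin 2) K) :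
      Matrix (Fin 2) (Fin 2) K) *ᵥ ![1, θ] = c • ![1, θ]) :
    c ^ 2 - algebraMap k K (Matrix.trace (t : Matrix (Fin 2) (Fin 2) k)) * c + 1 = 0 := by
  rw [mapGL_coe] at hc
  have e0 := congrFun hc 0
  have e1 := congrFun hc 1
  simp only [Matrix.mulVec, dotProduct, Fin.sum_univ_two, Matrix.map_apply, Matrix.cons_val_zero,
    Matrix.cons_val_one, mul_one, Pi.smul_apply, smul_eq_mul] at e0 e1
  have hdet : (t : Matrix (Fin 2) (Fin 2) k) 0 0 * (t : Matrix (Fin 2) (Fin 2) k) 1 1 -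
      (t : Matrix (Fin 2) (Fin 2) k) 0 1 * (t : Matrix (Fin 2) (Fin 2) k) 1 0 = 1 := by
    have h := t.2
    rw [Matrix.det_fin_two] at h
    exact h
  have hdetK := congrArg (algebraMap k K) hdet
  rw [map_sub, map_mul, map_mul, map_one] at hdetK
  rw [Matrix.trace_fin_two, map_add]
  linear_combination (algebraMap k K ((t : Matrix (Fin 2) (Fin 2) k) 1 1) - c) * e0 -
    (algebraMap k K ((t : Matrix (Fin 2) (Fin 2) k) 0 1)) * e1 - hdetK

omit [Fintype k] [DecidableEq k] [Fintype K] [DecidableEq K] in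
/-- In the stabiliser of the punctured line `Kˣ·(1, θ)` (`θ ∉ k`), trace `2` forces `t = 1`.
[folklore] -/
theorem stab_trace_two {θ : K} (hθ : θ ∉ Set.range (algebraMap k K))
    (t : Matrix.SpecialLinearGroup (Fin 2) k) (c : K)
    (hc : ((Matrix.SpecialLinearGroup.mapGL K t : Matrix.GeneralLinearGroup (Fin 2) K) :
      Matrix (Fin 2) (Fin 2) K) *ᵥ ![1, θ] = c • ![1, θ])
    (htr : Matrix.trace (t : Matrix (Fin 2) (Fin 2) k) = 2) : t = 1 := by
  have h := stab_charpoly θ t c hc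
  rw [htr, map_ofNat] at h
  have hc1 : c = 1 := by
    have : (c - 1) ^ 2 = 0 := by linear_combination h
    exact sub_eq_zero.1 (pow_eq_zero_iff two_ne_zero |>.1 this)
  rw [hc1, one_smul, mapGL_coe] at hc
  have h0 : (((t : Matrix (Fin 2) (Fin 2) k) - 1).map (algebraMap k K)) *ᵥ ![1, θ] = 0 := by
    rw [Matrix.map_sub _ (map_sub (algebraMap k K)), Matrix.map_one _ (map_zero _) (map_one _),
      Matrix.sub_mulVec, Matrix.one_mulVec, hc, sub_self]
  have := mapMatrix_mulVec_eq_zero hθ _ h0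
  exact Subtype.ext (by rw [Matrix.SpecialLinearGroup.coe_one]; exact sub_eq_zero.1 this)

omit [Fintype k] [DecidableEq k] [Fintype K] [DecidableEq K] in
/-- In the stabiliser of the punctured line `Kˣ·(1, θ)` (`θ ∉ k`), trace `−2` forces `t = −1`.
[folklore] -/
theorem stab_trace_neg_two {θ : K} (hθ : θ ∉ Set.range (algebraMap k K))
    (t : Matrix.SpecialLinearGroup (Fin 2) k) (c : K)
    (hc : ((Matrix.SpecialLinearGroup.mapGL K t : Matrix.GeneralLinearGroup (Fin 2) K) :
      Matrix (Fin 2) (Fin 2) K) *ᵥ ![1, θ] = c • ![1, θ])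
    (htr : Matrix.trace (t : Matrix (Fin 2) (Fin 2) k) = -2) : t = -1 := by
  have h := stab_charpoly θ t c hc
  rw [htr, map_neg, map_ofNat] at h
  have hc1 : c = -1 := by
    have : (c + 1) ^ 2 = 0 := by linear_combination h
    exact eq_neg_of_add_eq_zero_left (pow_eq_zero_iff two_ne_zero |>.1 this)
  rw [hc1, mapGL_coe] at hc
  have h0 : (((t : Matrix (Fin 2) (Fin 2) k) + 1).map (algebraMap k K)) *ᵥ ![1, θ] = 0 := by
    rw [Matrix.map_add _ (map_add (algebraMap k K)), Matrix.map_one _ (map_zero _) (map_one _),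
      Matrix.add_mulVec, Matrix.one_mulVec, hc, neg_one_smul, neg_add_cancel]
  have := mapMatrix_mulVec_eq_zero hθ _ h0
  exact Subtype.ext (by
    rw [Matrix.SpecialLinearGroup.coe_neg, Matrix.SpecialLinearGroup.coe_one]
    exact eq_neg_of_add_eq_zero_left this)

omit [Fintype K] in
/-- **The Steinberg kernel vector is not killed by `T_e`** (`hκ1`): for the extended trace form
`e = extTraceForm (ellTau s₀)` (any `s₀`) and `w₀ = (1, θ)`, `θ ∉ k`:
`Σ_t e(t)·[φ(t) w₀ ∈ Kˣ·w₀] ≠ 0` — it is an integer `≤ 2 − 2|k|`. [folklore] -/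
theorem stab_sum_ne_zero {θ : K} (hθ : θ ∉ Set.range (algebraMap k K)) (s₀ : k) :
    ∑ t : Matrix.SpecialLinearGroup (Fin 2) k, extTraceForm (ellTau s₀) t *
      (if ((Matrix.SpecialLinearGroup.mapGL K t : Matrix.GeneralLinearGroup (Fin 2) K).val *ᵥ
              ![1, θ]) 0 ≠ 0 ∧
          ((Matrix.SpecialLinearGroup.mapGL K t : Matrix.GeneralLinearGroup (Fin 2) K).val *ᵥ
              ![1, θ]) 1 =
            ((Matrix.SpecialLinearGroup.mapGL K t : Matrix.GeneralLinearGroup (Fin 2) K).val *ᵥ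
              ![1, θ]) 0 * θ
        then (1 : ℂ) else 0) ≠ 0 := by
  simp_rw [mul_boole]
  rw [← Finset.sum_filter]
  set S := Finset.univ.filter fun t : Matrix.SpecialLinearGroup (Fin 2) k =>
    ((Matrix.SpecialLinearGroup.mapGL K t : Matrix.GeneralLinearGroup (Fin 2) K).val *ᵥ
        ![1, θ]) 0 ≠ 0 ∧
      ((Matrix.SpecialLinearGroup.mapGL K t : Matrix.GeneralLinearGroup (Fin 2) K).val *ᵥ
          ![1, θ]) 1 =
        ((Matrix.SpecialLinearGroup.mapGL K t : Matrix.GeneralLinearGroup (Fin 2) K).val *ᵥ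
          ![1, θ]) 0 * θ with hS
  -- membership in `S` unpacked
  have hmem : ∀ t, t ∈ S → ∃ c : K, c ≠ 0 ∧
      ((Matrix.SpecialLinearGroup.mapGL K t : Matrix.GeneralLinearGroup (Fin 2) K) :
        Matrix (Fin 2) (Fin 2) K) *ᵥ ![1, θ] = c • ![1, θ] := by
    intro t ht
    rw [hS, Finset.mem_filter] at ht
    exact (puncturedLine_iff θ _).1 ht.2
  have h1S : (1 : Matrix.SpecialLinearGroup (Fin 2) k) ∈ S := by
    rw [hS, Finset.mem_filter]
    refine ⟨Finset.mem_univ _, ?_⟩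
    simp [map_one]
  have hm1S : (-1 : Matrix.SpecialLinearGroup (Fin 2) k) ∈ S := by
    rw [hS, Finset.mem_filter]
    refine ⟨Finset.mem_univ _, ?_⟩
    have hv : ((Matrix.SpecialLinearGroup.mapGL K (-1 : Matrix.SpecialLinearGroup (Fin 2) k) :
        Matrix.GeneralLinearGroup (Fin 2) K) : Matrix (Fin 2) (Fin 2) K) = -1 := by
      rw [mapGL_coe, Matrix.SpecialLinearGroup.coe_neg,
        Matrix.SpecialLinearGroup.coe_one, Matrix.map_neg _ (map_neg (algebraMap k K)),
        Matrix.map_one _ (map_zero _) (map_one _)]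
    rw [hv, Matrix.neg_mulVec, Matrix.one_mulVec]
    simp
  -- the trace-`±2` parts of `S` are `{1}`, `{-1}`
  have hn1 : (S.filter fun t : Matrix.SpecialLinearGroup (Fin 2) k =>
      Matrix.trace (t : Matrix (Fin 2) (Fin 2) k) = 2).card ≤ 1 := by
    refine Finset.card_le_one.2 fun a ha b hb => ?_
    rw [Finset.mem_filter] at ha hb
    obtain ⟨ca, -, hca⟩ := hmem a ha.1
    obtain ⟨cb, -, hcb⟩ := hmem b hb.1
    rw [stab_trace_two hθ a ca hca ha.2, stab_trace_two hθ b cb hcb hb.2]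
  have hn2 : (S.filter fun t : Matrix.SpecialLinearGroup (Fin 2) k =>
      Matrix.trace (t : Matrix (Fin 2) (Fin 2) k) = -2).card ≤ 1 := by
    refine Finset.card_le_one.2 fun a ha b hb => ?_
    rw [Finset.mem_filter] at ha hb
    obtain ⟨ca, -, hca⟩ := hmem a ha.1
    obtain ⟨cb, -, hcb⟩ := hmem b hb.1
    rw [stab_trace_neg_two hθ a ca hca ha.2, stab_trace_neg_two hθ b cb hcb hb.2]
  have hB1 : (S.filter fun t : Matrix.SpecialLinearGroup (Fin 2) k => t = 1).card = 1 := by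
    rw [Finset.card_eq_one]
    refine ⟨1, ?_⟩
    ext t
    simp only [Finset.mem_filter, Finset.mem_singleton]
    exact ⟨fun h => h.2, fun h => ⟨h ▸ h1S, h⟩⟩
  have hB2 : (S.filter fun t : Matrix.SpecialLinearGroup (Fin 2) k => t = -1).card = 1 := by
    rw [Finset.card_eq_one]
    refine ⟨-1, ?_⟩
    ext t
    simp only [Finset.mem_filter, Finset.mem_singleton]
    exact ⟨fun h => h.2, fun h => ⟨h ▸ hm1S, h⟩⟩
  have hq : 1 < Fintype.card k := Fintype.one_lt_card
  -- expand the sum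
  simp only [extTraceForm_apply, ellTau_apply, Finset.sum_sub_distrib, Finset.sum_add_distrib,
    ← Finset.mul_sum, Finset.sum_boole, hB1, hB2]
  intro h
  have h' : ((S.filter fun t : Matrix.SpecialLinearGroup (Fin 2) k =>
        Matrix.trace (t : Matrix (Fin 2) (Fin 2) k) = 2).card : ℂ) +
      ((S.filter fun t : Matrix.SpecialLinearGroup (Fin 2) k =>
        Matrix.trace (t : Matrix (Fin 2) (Fin 2) k) = -2).card : ℂ) =
      ((S.filter fun t : Matrix.SpecialLinearGroup (Fin 2) k =>
        Matrix.trace (t : Matrix (Fin 2) (Fin 2) k) = s₀).card : ℂ) +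
      ((S.filter fun t : Matrix.SpecialLinearGroup (Fin 2) k =>
        Matrix.trace (t : Matrix (Fin 2) (Fin 2) k) = -s₀).card : ℂ) +
      (Fintype.card k : ℂ) * 2 := by
    linear_combination h
  have h'' : (S.filter fun t : Matrix.SpecialLinearGroup (Fin 2) k =>
        Matrix.trace (t : Matrix (Fin 2) (Fin 2) k) = 2).card +
      (S.filter fun t : Matrix.SpecialLinearGroup (Fin 2) k =>
        Matrix.trace (t : Matrix (Fin 2) (Fin 2) k) = -2).card =
      (S.filter fun t : Matrix.SpecialLinearGroup (Fin 2) k =>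
        Matrix.trace (t : Matrix (Fin 2) (Fin 2) k) = s₀).card +
      (S.filter fun t : Matrix.SpecialLinearGroup (Fin 2) k =>
        Matrix.trace (t : Matrix (Fin 2) (Fin 2) k) = -s₀).card +
      Fintype.card k * 2 := by
    exact_mod_cast h'
  omega

end Stabiliser

/-- The standard embedding `mapGL K : SL₂(k) →* GL₂(K)` is injective (field extension). -/
theorem mapGL_injective_of_field (k K : Type) [Field k] [Field K] [Algebra k K] :
    Function.Injective (Matrix.SpecialLinearGroup.mapGL K :
      Matrix.SpecialLinearGroup (Fin 2) k →* Matrix.GeneralLinearGroup (Fin 2) K) := by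
  intro g g' h
  have h' := congrArg (fun u : Matrix.GeneralLinearGroup (Fin 2) K =>
    (u : Matrix (Fin 2) (Fin 2) K)) h
  exact Subtype.ext (Matrix.map_injective (algebraMap k K).injective h')

/-- **The sharp uniform counting wall.**  For EVERY finite field `k`, every field `K` that is a
`k`-algebra with `|K| = |k|²`, the standard embedding `φ = mapGL K : SL₂(k) →* GL₂(K)`, and all
non-empty `Y, Z ⊆ GL₂(K)` separated from `φ(SL₂ k)` by level-one frame functions exactly as in S3:
`|Y| + |Z| ≤ (|K| + 1)(|k| − 1)`  (`= 5, 20, 51, 104, 300, …` at `|k| = 2, 3, 4, 5, 7, …`).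
`cuspFormWall_sharp` with the elliptic extended trace form and the Steinberg kernel vector.
A theorem about the finite cells; it decides nothing about S3 or the summit. [folklore] -/
theorem subfieldCell_wall_sharp_uniform {k K : Type} [Field k] [Fintype k] [DecidableEq k]
    [Field K] [Fintype K] [DecidableEq K] [Algebra k K]
    (hK : Fintype.card K = Fintype.card k ^ 2)
    (Y Z : Finset (Matrix.GeneralLinearGroup (Fin 2) K)) (hY : Y.Nonempty) (hZ : Z.Nonempty)
    (hsep : ∀ z₀ ∈ Z, ∃ cf : (Fin 2 → K) → (Fin 2 → K) → ℂ,
      ∀ a : Matrix.SpecialLinearGroup (Fin 2) k, ∀ y ∈ Y, ∀ y' ∈ Y, ∀ z ∈ Z,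
        (∑ u : Fin 2 → K, cf u (((Matrix.SpecialLinearGroup.mapGL K a * y * y'⁻¹ * z :
            Matrix.GeneralLinearGroup (Fin 2) K) : Matrix (Fin 2) (Fin 2) K).mulVec u)) =
          if a = 1 ∧ y = y' ∧ z = z₀ then 1 else 0) :
    Y.card + Z.card ≤ (Fintype.card K + 1) * (Fintype.card k - 1) := by
  obtain ⟨s₀, hs₀⟩ := exists_elliptic_trace k
  obtain ⟨θ, hθ⟩ := exists_not_mem_range_algebraMap (k := k) (K := K) hK
  have hcusp := extTraceForm_cusp (ellTau s₀) (ellTau_sum s₀) (ellTau_split s₀ hs₀)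
  refine cuspFormWall_sharp (Matrix.SpecialLinearGroup.mapGL K) (mapGL_injective_of_field k K)
    hK Y Z hY hZ hsep (extTraceForm (ellTau s₀)) ⟨_, extTraceForm_ellTau_ne_zero s₀ hs₀⟩ hcusp
    (fun _ w => if w 0 ≠ 0 ∧ w 1 = w 0 * θ then 1 else 0) ?_ ?_
  · -- `hκ0`: one representative per punctured line, then `Σ e = 0`
    intro g
    rw [Finset.sum_comm]
    simp_rw [← Finset.mul_sum, Matrix.mulVec_mulVec, ← Units.val_mul, lineRep_count, mul_one]
    exact cuspForm_sum_eq_zero _ hcusp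
  · -- `hκ1`: the stabiliser sum is a negative integer
    refine ⟨![0, 1], Finset.mem_insert_self _ _, ![1, θ], ?_⟩
    exact stab_sum_ne_zero hθ s₀

/-- **Sharp uniform area bound**: in the same configuration `4·|Y|·|Z| ≤ ((|K| + 1)(|k| − 1))²`. -/
theorem subfieldCell_area_le_sharp_uniform {k K : Type} [Field k] [Fintype k] [DecidableEq k]
    [Field K] [Fintype K] [DecidableEq K] [Algebra k K]
    (hK : Fintype.card K = Fintype.card k ^ 2)
    (Y Z : Finset (Matrix.GeneralLinearGroup (Fin 2) K)) (hY : Y.Nonempty) (hZ : Z.Nonempty)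
    (hsep : ∀ z₀ ∈ Z, ∃ cf : (Fin 2 → K) → (Fin 2 → K) → ℂ,
      ∀ a : Matrix.SpecialLinearGroup (Fin 2) k, ∀ y ∈ Y, ∀ y' ∈ Y, ∀ z ∈ Z,
        (∑ u : Fin 2 → K, cf u (((Matrix.SpecialLinearGroup.mapGL K a * y * y'⁻¹ * z :
            Matrix.GeneralLinearGroup (Fin 2) K) : Matrix (Fin 2) (Fin 2) K).mulVec u)) =
          if a = 1 ∧ y = y' ∧ z = z₀ then 1 else 0) :
    4 * (Y.card * Z.card) ≤ ((Fintype.card K + 1) * (Fintype.card k - 1)) ^ 2 := by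
  have h := subfieldCell_wall_sharp_uniform hK Y Z hY hZ hsep
  have h4 : 4 * (Y.card * Z.card) ≤ (Y.card + Z.card) ^ 2 := by
    zify
    nlinarith [sq_nonneg ((Y.card : ℤ) - Z.card)]
  exact h4.trans (Nat.pow_le_pow_left h 2)

end Summit.MatrixMultiplication.MatrixMultiplication.Theorems.GradedDesignFamily.Negative
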